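import Summits.QuantumFields.BalabanUV.T4Continuum.Spine.NE2.CovariantTableBalaban
import Summits.QuantumFields.BalabanUV.T4Continuum.Spine.NE2.CovariantTablePairing
import Summits.QuantumFields.BalabanUV.T4Continuum.Support.CovariantVectorChartModulus
import Mathlib.Data.Nat.MaxPowDiv

/-!
# T⁴ programme, spine node NE2 (U1a) — R14 W2, file 3: THE TWO-LEVEL ENTRY LAW OF BAŁABAN's COMPOSED TABLE `T_Bal` — factorisation, carry cascade, sizes only
# (cell `pub-balaban-gaps`, seat ne2 gen 4; plan `run/shared/lean/pub/pub-balaban-gaps/ne/NE2-R14-PLAN.md` W2 / STATUS v3)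

`CovariantTableBalaban.TBal W k y j μ t = Π_{i=1}^{k} stepT W k y j μ t i` is print's COMPOSED main-term averaging [B9] (3.15) / [B7] (125) as a transporter table (the
chain through the digits of `(j, t)`).  The two-level pairing (`CovariantTablePairing.pairDT`) compares the level-`(k+1)` entry of the fine pair `(L·j + r, t′)` with the
level-`k` entry of its GEOMETRIC parent `(j, ⌊(r_μ + t′)/L⌋)`.  THIS FILE proves, from SIZES ONLY (no curvature, no axial-consistency letter):
 * §1–§2 digit bookkeeping and **`stepT_succ`**: the steps `i ≤ k` of the `(k+1)`-chain of `(L·j + r, t′)` ARE the steps of the `k`-chain of `(j, ⌊t′/L⌋)` (same data);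
   **`TBal_succ`**: `TBal W (k+1) y (L·j+r) μ t′ = TBal W k y j μ ⌊t′/L⌋ · stepT W (k+1) … (k+1)` (exact factorisation);
 * §3 **`stepT_eq_of_not_dvd`**: under `t ↦ t + 1` the step at level `i` is UNCHANGED unless `L^{k−i} ∣ t + 1` — so a carry of depth `v = v_L(t+1)` (`padicValNat L (t+1)`, any
   base `L ≥ 2`) moves only the levels `i ≥ k − v`, and the first `cutBal L k t = k − 1 − v` levels of `TBal W k y j μ (t+1)` and `TBal W k y j μ t` coincide (`TBal_prefix_eq`);
 * §4 norms: products of contractions, telescoping (`norm_prod_sub_prod_le`), `‖A′X − AY‖ ≤ ‖A′ − A‖ + ‖X − 1‖ + ‖Y − 1‖`;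
 * §5 **`TBal_two_level_entry`**: for data towers `W` (level-`k` problem) and `W′` (level-`(k+1)` problem) of CONTRACTIONS with per-level sizes `‖W i − 1‖, ‖W′ i − 1‖ ≤ a_i`
   and per-level consistency `‖W′ i − W i‖ ≤ c_i`:
   `‖TBal W′ (k+1) y (L·j+r) μ t′ − TBal W k y j μ ⌊(r_μ+t′)/L⌋‖ ≤ thetaBal d L a c k ⌊t′/L⌋ = consBal + 2·tailBal`, where `consBal = Σ_{i≤k}((1+c_i)^{(d+1)L} − 1)` (data
   consistency along the common prefix) and `tailBal k t₀ = Π_{i=cutBal+1}^{k+1}(1 + a_i)^{(d+1)L} − 1` (sizes of the levels the carry cascade can touch, the finest step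
   included); its MEAN over `t′` is `O((k+1)·α·L^{−k})` for `a_i = α·L^{−i}` (file 4), its SUP `O(α)` (depth `v = k`) — why W1's sup-form `hT2` is the wrong currency here.
HONEST FRAMING (T4-DAG p. 1).  Bookkeeping about a TYPED table on the tree's finite tori; `W`, `W′`, `a`, `c` DATA/hypotheses asserted by nobody; in the intended reading
`W i = Ad Ū^{(k−i)}` ([B7] (15)'s group-valued averages — UNTYPED, DIVERGENCE F6 (ζ) — so nothing of them is constructed); NOT NE2, NOT [B9] (3.16)/(3.26) as printed; NE2 (U1a)
NOT PROVED; spine PROVED 0/9 unchanged; NOT continuum YM / infinite volume / mass gap / Clay.  HONEST DEPENDENCY: continuum YM on T⁴ ⇐ BetaPertH ∧ nine spine estimates (0/9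
proved); BetaPertH ⇐ (D1) ∧ (D4) ∧ CAP+tail; G-an2-4 gates asym, D1 and NE2/3/4.  No `sorry`.
-/

noncomputable section

open scoped BigOperators ComplexConjugate Matrix Matrix.Norms.L2Operator Kronecker

namespace Summit.QuantumFields.BalabanUV.T4Continuum.NE2.CovariantTableBalabanTwoLevel

open Literature.MathematicalPhysics.QuantumFieldTheory.Balaban1983to89.B5Prop11Plancherel (Tor fine unitVec)
open Literature.MathematicalPhysics.QuantumFieldTheory.Balaban1983to89.B5Block118 (QvOp bpt tstep up)
open Literature.MathematicalPhysics.QuantumFieldTheory.Balaban1983to89.B5G183RateUnitTower (lev lev_neZero)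
open Summit.QuantumFields.BalabanUV.T4Continuum.BalabanAveragedTowerUnit (idx)
open Summit.QuantumFields.BalabanUV.T4Continuum.CovariantBlockAveraging (transport transport_one norm_transport_sub_one_le leg length_leg norm_listProd_sub_one_le)
open Summit.QuantumFields.BalabanUV.T4Continuum.CovariantVectorChartModulus (norm_transport_le_one norm_transport_sub_transport_le norm_list_prod_le_one)
open Summit.QuantumFields.BalabanUV.T4Continuum.LineAveragingPairing (glue glue_val)
open Summit.QuantumFields.BalabanUV.T4Continuum.NE2.CovariantTableAveraging (Table QcovT norm_mul_sub_one_le)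
open Summit.QuantumFields.BalabanUV.T4Continuum.NE2.CovariantTableBalaban (lpt contourFrom length_contourFrom digit digit_lt coordAt stepT TBal norm_stepT_sub_one_le
  norm_prod_stepT_sub_one_le)

variable {d : ℕ} (L : ℕ) [NeZero L] (M : Fin d → ℕ) [hM : ∀ μ, NeZero (M μ)] {o : Type*} [Fintype o] [DecidableEq o]

/-! ## §1 Digits and quotients of a glued offset `L·a + r` and of a line position `t′` vs `⌊t′/L⌋` -/

omit [NeZero L] in
/-- `(L·a + r)/L^{m+1} = a/L^m` (`r < L`). [folklore] -/
theorem mul_add_div_pow_succ (hL : 0 < L) (m a r : ℕ) (hr : r < L) : (L * a + r) / L ^ (m + 1) = a / L ^ m := by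
  rw [pow_succ', ← Nat.div_div_eq_div_mul, Nat.mul_add_div hL, Nat.div_eq_of_lt hr, add_zero]

omit [NeZero L] in
/-- `t/L^{m+1} = (t/L)/L^m`. [folklore] -/
theorem div_pow_succ (m t : ℕ) : t / L ^ (m + 1) = t / L / L ^ m := by rw [pow_succ', Nat.div_div_eq_div_mul]

omit [NeZero L] in
/-- digits of a glued offset: `digit_{m+1}(L·a + r) = digit_m(a)`. [folklore] -/
theorem digit_succ_glue (hL : 0 < L) (m a r : ℕ) (hr : r < L) : digit L (m + 1) (L * a + r) = digit L m a := by
  unfold digit; rw [mul_add_div_pow_succ L hL m a r hr]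

omit [NeZero L] in
/-- the lowest digit of a glued offset is the sub-block offset: `digit_0(L·a + r) = r`. [folklore] -/
theorem digit_zero_glue (a r : ℕ) (hr : r < L) : digit L 0 (L * a + r) = r := by
  unfold digit; rw [pow_zero, Nat.div_one, Nat.mul_add_mod, Nat.mod_eq_of_lt hr]

omit [NeZero L] in
/-- `digit_{m+1}(t) = digit_m(⌊t/L⌋)`. [folklore] -/
theorem digit_succ_div (m t : ℕ) : digit L (m + 1) t = digit L m (t / L) := by unfold digit; rw [div_pow_succ]

omit [NeZero L] in
/-- `digit_0(t) = t mod L`. [folklore] -/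
theorem digit_zero (t : ℕ) : digit L 0 t = t % L := by unfold digit; rw [pow_zero, Nat.div_one]

/-! ## §2 The steps `i ≤ k` of the `(k+1)`-chain are the steps of the `k`-chain; the factorisation of `T_Bal` -/

omit [NeZero L] in
/-- the intermediate bond bases agree: `coordAt (k+1) i (L·j + r) μ t′ = coordAt k i j μ ⌊t′/L⌋` (`i ≤ k`). [folklore] -/
theorem coordAt_succ (hL : 0 < L) {k i : ℕ} (hi : i ≤ k) (j r : Fin d → ℕ) (hr : ∀ ν, r ν < L) (μ : Fin d) (t' : ℕ) :
    coordAt L (k + 1) i (fun ν => L * j ν + r ν) μ t' = coordAt L k i j μ (t' / L) := by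
  funext ν
  have h1 : k + 1 - i = (k - i) + 1 := by omega
  simp only [coordAt, h1, mul_add_div_pow_succ L hL _ _ _ (hr ν), div_pow_succ L (k - i) t']

omit hM in
/-- **THE STEPS `1 ≤ i ≤ k` OF THE `(k+1)`-CHAIN OF `(L·j + r, t′)` ARE THE STEPS OF THE `k`-CHAIN OF `(j, ⌊t′/L⌋)`** (same data `W`). [folklore] -/
theorem stepT_succ {k i : ℕ} (hi1 : 1 ≤ i) (hik : i ≤ k) (W : (i : ℕ) → Fin d → (idx L M i → Matrix o o ℂ)) (y : Tor M)
    (j r : Fin d → ℕ) (hr : ∀ ν, r ν < L) (μ : Fin d) (t' : ℕ) :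
    stepT L M W (k + 1) y (fun ν => L * j ν + r ν) μ t' i = stepT L M W k y j μ (t' / L) i := by
  have hL : 0 < L := Nat.pos_of_ne_zero (NeZero.ne L)
  have h1 : k + 1 - i = (k - i) + 1 := by omega
  have hd : (fun ν => digit L (k + 1 - i) (L * j ν + r ν)) = fun ν => digit L (k - i) (j ν) := by
    funext ν; rw [h1, digit_succ_glue L hL _ _ _ (hr ν)]
  rw [stepT, stepT, coordAt_succ L hL (by omega : i - 1 ≤ k) j r hr μ t', hd, h1, digit_succ_div]

omit hM in
/-- **THE FACTORISATION**: `TBal W (k+1) y (L·j + r) μ t′ = TBal W k y j μ ⌊t′/L⌋ · stepT W (k+1) y (L·j + r) μ t′ (k+1)` — the `(k+1)`-chain of a fine pair is the `k`-chain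
of its COMPOSITIONAL parent `(j, ⌊t′/L⌋)` followed by the finest step. [cite: Balaban1985BackgroundPropagators, (3.15) p.393 (shape)] [folklore] -/
theorem TBal_succ (W : (i : ℕ) → Fin d → (idx L M i → Matrix o o ℂ)) (k : ℕ) (y : Tor M) (j : Fin d → Fin (lev L k)) (r : Fin d → Fin L)
    (μ : Fin d) (t' : ℕ) :
    TBal L M W (k + 1) y (glue (lev L k) L (j, r)) μ t'
      = TBal L M W k y j μ (t' / L) * stepT L M W (k + 1) y (fun ν => L * (j ν : ℕ) + (r ν : ℕ)) μ t' (k + 1) := by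
  have hglue : (fun ν => ((glue (lev L k) L (j, r) ν : ℕ))) = fun ν => L * (j ν : ℕ) + (r ν : ℕ) := funext fun ν => glue_val _ _ _ _
  rw [TBal, TBal, hglue, List.range_succ, List.map_append, List.prod_append, List.map_singleton, List.prod_singleton]
  congr 1
  refine congrArg List.prod (List.map_congr_left fun i' hi' => ?_)
  rw [List.mem_range] at hi'
  exact stepT_succ L M (by omega) (by omega) W y _ _ (fun ν => (r ν).isLt) μ t'

/-! ## §3 The carry cascade: which levels a unit step `t ↦ t + 1` of the line position can move -/

omit hM in
/-- **A LEVEL THE CARRY DOES NOT REACH IS UNCHANGED**: if `L^{k−i} ∤ t + 1` (`1 ≤ i ≤ k`) then `stepT W k y j μ (t+1) i = stepT W k y j μ t i` (the digit at position `k − i`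
and the quotient at position `k − i + 1` of `t + 1` and `t` agree). [folklore] -/
theorem stepT_eq_of_not_dvd {k i t : ℕ} (hi1 : 1 ≤ i) (hik : i ≤ k) (hnd : ¬ L ^ (k - i) ∣ t + 1)
    (W : (i : ℕ) → Fin d → (idx L M i → Matrix o o ℂ)) (y : Tor M) (j : Fin d → ℕ) (μ : Fin d) :
    stepT L M W k y j μ (t + 1) i = stepT L M W k y j μ t i := by
  have hq : (t + 1) / L ^ (k - i) = t / L ^ (k - i) := Nat.succ_div_of_not_dvd hnd
  have hq' : (t + 1) / L ^ (k - (i - 1)) = t / L ^ (k - (i - 1)) := by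
    have : k - (i - 1) = (k - i) + 1 := by omega
    rw [this, pow_succ, ← Nat.div_div_eq_div_mul, ← Nat.div_div_eq_div_mul, hq]
  have hc : coordAt L k (i - 1) j μ (t + 1) = coordAt L k (i - 1) j μ t := by
    funext ν; simp only [coordAt, hq']
  have hdig : digit L (k - i) (t + 1) = digit L (k - i) t := by unfold digit; rw [hq]
  rw [stepT, stepT, hc, hdig]

/-- the number of leading levels a unit step of the line position at `t` cannot move: `k − 1 − v_L(t+1)` (truncated subtraction; `0` when the carry reaches the coarsest
level). [folklore] -/
def cutBal (L k t : ℕ) : ℕ := k - 1 - padicValNat L (t + 1)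

omit [NeZero L] in
/-- `cutBal ≤ k`. [folklore] -/
theorem cutBal_le (k t : ℕ) : cutBal L k t ≤ k := by unfold cutBal; omega

omit [NeZero L] in
/-- below the cut the carry does not reach: for `i ≤ cutBal L k t` (and `L ≥ 2`), `L^{k−i} ∤ t + 1`. [folklore] -/
theorem not_dvd_of_le_cutBal (hL : 2 ≤ L) {k i t : ℕ} (hi : i ≤ cutBal L k t) (hi1 : 1 ≤ i) : ¬ L ^ (k - i) ∣ t + 1 := by
  intro h
  have hL1 : L ≠ 1 := by omega
  have hle : padicValNat L (t + 1) + 1 ≤ k - i := by unfold cutBal at hi; omega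
  have h2 : L ^ (padicValNat L (t + 1) + 1) ∣ t + 1 := (Nat.pow_dvd_pow L hle).trans h
  have h3 := (Nat.pow_dvd_iff_le_padicValNat hL1 (by omega : t + 1 ≠ 0)).mp h2
  omega

omit hM in
/-- **THE COMMON PREFIX**: the first `cutBal L k t` steps of the chains at `t + 1` and at `t` coincide. [folklore] -/
theorem TBal_prefix_eq (hL : 2 ≤ L) (W : (i : ℕ) → Fin d → (idx L M i → Matrix o o ℂ)) (k t : ℕ) (y : Tor M) (j : Fin d → ℕ) (μ : Fin d) :
    ((List.range (cutBal L k t)).map fun i' => stepT L M W k y j μ (t + 1) (i' + 1))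
      = (List.range (cutBal L k t)).map fun i' => stepT L M W k y j μ t (i' + 1) := by
  refine List.map_congr_left fun i' hi' => ?_
  rw [List.mem_range] at hi'
  have hcut := cutBal_le L k t
  exact stepT_eq_of_not_dvd L M (by omega) (by omega) (not_dvd_of_le_cutBal L hL (by omega) (by omega)) W y j μ

omit [NeZero L] in
/-- splitting the chain at the cut: `range k = range m ++ (range (k − m)).map (m + ·)`. [folklore] -/
theorem range_split {m k : ℕ} (hm : m ≤ k) : List.range k = List.range m ++ (List.range (k - m)).map (m + ·) := by
  have h := @List.range_add m (k - m)
  rwa [Nat.add_sub_cancel' hm] at h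

/-! ## §4 Norm bookkeeping for products of contractions -/

section Norms

variable {ι : Type*} [Nonempty o]

/-- **TELESCOPING**: for contractions, `‖Π f − Π g‖ ≤ Σ ‖f − g‖` along a list. [folklore] -/
theorem norm_prod_sub_prod_le (l : List ι) (f g : ι → Matrix o o ℂ) (hf : ∀ i ∈ l, ‖f i‖ ≤ 1) (hg : ∀ i ∈ l, ‖g i‖ ≤ 1) :
    ‖(l.map f).prod - (l.map g).prod‖ ≤ (l.map fun i => ‖f i - g i‖).sum := by
  induction l with
  | nil => simp
  | cons a l ih =>
    rw [List.map_cons, List.map_cons, List.prod_cons, List.prod_cons, List.map_cons, List.sum_cons]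
    have hfa : ‖f a‖ ≤ 1 := hf a (List.mem_cons_self)
    have hga : ‖g a‖ ≤ 1 := hg a (List.mem_cons_self)
    have hPf : ‖(l.map f).prod‖ ≤ 1 := norm_list_prod_le_one l f fun b hb => hf b (List.mem_cons_of_mem a hb)
    have e : f a * (l.map f).prod - g a * (l.map g).prod = (f a - g a) * (l.map f).prod + g a * ((l.map f).prod - (l.map g).prod) := by
      noncomm_ring
    rw [e]
    calc _ ≤ ‖(f a - g a) * (l.map f).prod‖ + ‖g a * ((l.map f).prod - (l.map g).prod)‖ := norm_add_le _ _
      _ ≤ ‖f a - g a‖ * ‖(l.map f).prod‖ + ‖g a‖ * ‖(l.map f).prod - (l.map g).prod‖ := add_le_add (norm_mul_le _ _) (norm_mul_le _ _)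
      _ ≤ ‖f a - g a‖ * 1 + 1 * (l.map fun i => ‖f i - g i‖).sum := by
          gcongr
          exact ih (fun b hb => hf b (List.mem_cons_of_mem a hb)) (fun b hb => hg b (List.mem_cons_of_mem a hb))
      _ = _ := by ring

omit [Nonempty o] in
/-- `‖A′X − AY‖ ≤ ‖A′ − A‖ + ‖X − 1‖ + ‖Y − 1‖` for contractions `A`, `X`. [folklore] -/
theorem norm_mul_sub_mul_le_three {A A' X Y : Matrix o o ℂ} (hA : ‖A‖ ≤ 1) (hX : ‖X‖ ≤ 1) :
    ‖A' * X - A * Y‖ ≤ ‖A' - A‖ + ‖X - 1‖ + ‖Y - 1‖ := by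
  have e : A' * X - A * Y = (A' - A) * X + A * ((X - 1) - (Y - 1)) := by noncomm_ring
  rw [e]
  calc _ ≤ ‖(A' - A) * X‖ + ‖A * ((X - 1) - (Y - 1))‖ := norm_add_le _ _
    _ ≤ ‖A' - A‖ * ‖X‖ + ‖A‖ * ‖(X - 1) - (Y - 1)‖ := add_le_add (norm_mul_le _ _) (norm_mul_le _ _)
    _ ≤ ‖A' - A‖ * 1 + 1 * (‖X - 1‖ + ‖Y - 1‖) := by gcongr; exact norm_sub_le _ _
    _ = _ := by ring

end Norms

/-! ## §5 The two-level entry law of the composed table -/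

/-- the DATA-CONSISTENCY part of the weight: `Σ_{i=1}^{k} ((1 + c_i)^{(d+1)L} − 1)` (per-level consistency `c_i` of the two data towers along the one-step contours of
`≤ (d+1)·L` bonds). [folklore] -/
def consBal (d L : ℕ) (c : ℕ → ℝ) (k : ℕ) : ℝ := ((List.range k).map fun i' => (1 + c (i' + 1)) ^ ((d + 1) * L) - 1).sum

/-- the CARRY-CASCADE part of the weight at line position `t₀`: `Π_{i=cutBal+1}^{k+1} (1 + a_i)^{(d+1)L} − 1` (sizes of the levels a unit step at `t₀` can move, the finest
step `k + 1` included). [folklore] -/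
def tailBal (d L : ℕ) (a : ℕ → ℝ) (k t₀ : ℕ) : ℝ :=
  ((List.range (k + 1 - cutBal L k t₀)).map fun i' => (1 + a (cutBal L k t₀ + i' + 1)) ^ ((d + 1) * L)).prod - 1

/-- **THE TWO-LEVEL CONSISTENCY WEIGHT OF THE COMPOSED TABLE** at line position `t₀ = ⌊t′/L⌋`: `consBal + 2·tailBal`. [folklore] -/
def thetaBal (d L : ℕ) (a c : ℕ → ℝ) (k t₀ : ℕ) : ℝ := consBal d L c k + 2 * tailBal d L a k t₀

omit [NeZero L] in
/-- products of factors `≥ 1` are `≥ 1`. [folklore] -/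
theorem one_le_prod_of_one_le (l : List ℕ) (f : ℕ → ℝ) (hf : ∀ i, 1 ≤ f i) : 1 ≤ (l.map f).prod := by
  induction l with
  | nil => simp
  | cons a l ih => rw [List.map_cons, List.prod_cons]; exact one_le_mul_of_one_le_of_one_le (hf a) ih

omit [NeZero L] in
/-- `consBal ≥ 0` for `c ≥ 0`. [folklore] -/
theorem consBal_nonneg {c : ℕ → ℝ} (hc : ∀ i, 0 ≤ c i) (k : ℕ) : 0 ≤ consBal d L c k := by
  unfold consBal
  refine List.sum_nonneg fun x hx => ?_
  obtain ⟨i', _, rfl⟩ := List.mem_map.mp hx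
  exact sub_nonneg.mpr (one_le_pow₀ (by linarith [hc (i' + 1)]))

omit [NeZero L] in
/-- `tailBal ≥ 0` for `a ≥ 0`. [folklore] -/
theorem tailBal_nonneg {a : ℕ → ℝ} (ha : ∀ i, 0 ≤ a i) (k t₀ : ℕ) : 0 ≤ tailBal d L a k t₀ := by
  unfold tailBal
  exact sub_nonneg.mpr (one_le_prod_of_one_le _ _ fun i => one_le_pow₀ (by linarith [ha (cutBal L k t₀ + i + 1)]))

omit [NeZero L] in
/-- the finest step alone is dominated by the cascade part: `(1 + a_{k+1})^{(d+1)L} − 1 ≤ tailBal k t₀`. [folklore] -/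
theorem pow_sub_one_le_tailBal {a : ℕ → ℝ} (ha : ∀ i, 0 ≤ a i) (k t₀ : ℕ) : (1 + a (k + 1)) ^ ((d + 1) * L) - 1 ≤ tailBal d L a k t₀ := by
  have hcut := cutBal_le L k t₀
  have hsplit : k + 1 - cutBal L k t₀ = (k - cutBal L k t₀) + 1 := by omega
  unfold tailBal
  rw [hsplit, List.range_succ, List.map_append, List.prod_append, List.map_singleton, List.prod_singleton,
    show cutBal L k t₀ + (k - cutBal L k t₀) + 1 = k + 1 by omega]
  refine sub_le_sub_right ?_ 1
  exact le_mul_of_one_le_left (pow_nonneg (by linarith [ha (k + 1)]) _)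
    (one_le_prod_of_one_le _ _ fun i => one_le_pow₀ (by linarith [ha (cutBal L k t₀ + i + 1)]))

omit hM in
/-- the size of one step read with the data's per-level size. [folklore] -/
theorem norm_stepT_le_one [Nonempty o] {W : (i : ℕ) → Fin d → (idx L M i → Matrix o o ℂ)} (hWn : ∀ i ν b, ‖W i ν b‖ ≤ 1)
    (k : ℕ) (y : Tor M) (j : Fin d → ℕ) (μ : Fin d) (t : ℕ) (i : ℕ) : ‖stepT L M W k y j μ t i‖ ≤ 1 := by
  haveI := lev_neZero L i
  rw [stepT]; exact norm_transport_le_one _ (hWn i) μ _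

omit hM in
/-- **STEP CONSISTENCY**: the same step read with two data towers differs by at most `(1 + c_i)^{(d+1)L} − 1` (`‖W′ i − W i‖ ≤ c_i` per bond, `W` contractive). [folklore] -/
theorem norm_stepT_sub_stepT_le [Nonempty o] {W W' : (i : ℕ) → Fin d → (idx L M i → Matrix o o ℂ)} {c : ℕ → ℝ} (hc : ∀ i, 0 ≤ c i)
    (hWn : ∀ i ν b, ‖W i ν b‖ ≤ 1) (hWc : ∀ i ν b, ‖W' i ν b - W i ν b‖ ≤ c i)
    (k : ℕ) (y : Tor M) (j : Fin d → ℕ) (μ : Fin d) (t : ℕ) (i : ℕ) :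
    ‖stepT L M W' k y j μ t i - stepT L M W k y j μ t i‖ ≤ (1 + c i) ^ ((d + 1) * L) - 1 := by
  haveI := lev_neZero L i
  have hL : 0 < L := Nat.pos_of_ne_zero (NeZero.ne L)
  rw [stepT, stepT]
  refine norm_transport_sub_transport_le _ (hc i) (hWn i) (hWc i) μ ?_
  rw [length_contourFrom]
  calc (∑ ν, digit L (k - i) (j ν)) + digit L (k - i) t ≤ (∑ _ν : Fin d, L) + L :=
        add_le_add (Finset.sum_le_sum fun ν _ => (digit_lt L hL _ _).le) (digit_lt L hL _ _).le
    _ = (d + 1) * L := by rw [Finset.sum_const, Finset.card_univ, Fintype.card_fin, smul_eq_mul]; ring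

omit hM in
/-- **PREFIX CONSISTENCY**: `‖Π_{i'<m} stepT W′ … (i'+1) − Π_{i'<m} stepT W … (i'+1)‖ ≤ consBal d L c k` for `m ≤ k`. [folklore] -/
theorem norm_prefix_sub_prefix_le [Nonempty o] {W W' : (i : ℕ) → Fin d → (idx L M i → Matrix o o ℂ)} {c : ℕ → ℝ} (hc : ∀ i, 0 ≤ c i)
    (hWn : ∀ i ν b, ‖W i ν b‖ ≤ 1) (hW'n : ∀ i ν b, ‖W' i ν b‖ ≤ 1) (hWc : ∀ i ν b, ‖W' i ν b - W i ν b‖ ≤ c i)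
    {k m : ℕ} (hm : m ≤ k) (y : Tor M) (j : Fin d → ℕ) (μ : Fin d) (t : ℕ) :
    ‖((List.range m).map fun i' => stepT L M W' k y j μ t (i' + 1)).prod - ((List.range m).map fun i' => stepT L M W k y j μ t (i' + 1)).prod‖
      ≤ consBal d L c k := by
  refine (norm_prod_sub_prod_le _ _ _ (fun i' _ => norm_stepT_le_one L M hW'n k y j μ t (i' + 1))
    (fun i' _ => norm_stepT_le_one L M hWn k y j μ t (i' + 1))).trans ?_
  calc ((List.range m).map fun i' => ‖stepT L M W' k y j μ t (i' + 1) - stepT L M W k y j μ t (i' + 1)‖).sum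
      ≤ ((List.range m).map fun i' => (1 + c (i' + 1)) ^ ((d + 1) * L) - 1).sum :=
        List.sum_le_sum fun i' _ => norm_stepT_sub_stepT_le L M hc hWn hWc k y j μ t (i' + 1)
    _ ≤ consBal d L c k := by
        unfold consBal
        rw [range_split hm, List.map_append, List.sum_append]
        refine le_add_of_nonneg_right (List.sum_nonneg fun x hx => ?_)
        obtain ⟨i', _, rfl⟩ := List.mem_map.mp hx
        exact sub_nonneg.mpr (one_le_pow₀ (by linarith [hc (i' + 1)]))

omit hM in
/-- the line position of the geometric parent is the compositional one or its successor: `⌊(ρ + t′)/L⌋ ∈ {⌊t′/L⌋, ⌊t′/L⌋ + 1}` (`ρ < L`). [folklore] -/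
theorem parent_pos_cases {ρ : ℕ} (hρ : ρ < L) (t' : ℕ) : (ρ + t') / L = t' / L ∨ (ρ + t') / L = t' / L + 1 := by
  have hL : 0 < L := Nat.pos_of_ne_zero (NeZero.ne L)
  have ht : t' = L * (t' / L) + t' % L := (Nat.div_add_mod t' L).symm
  have hs : t' % L < L := Nat.mod_lt _ hL
  set q := t' / L
  set s := t' % L
  have e : ρ + t' = L * q + (ρ + s) := by rw [ht]; ring
  rw [e, Nat.mul_add_div hL]
  rcases lt_or_ge (ρ + s) L with h | h
  · left; rw [Nat.div_eq_of_lt h, add_zero]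
  · right
    congr 1
    rw [Nat.div_eq_sub_div hL h, Nat.div_eq_of_lt (by omega), zero_add]

omit hM in
/-- **THE TWO-LEVEL ENTRY LAW OF BAŁABAN's COMPOSED TABLE (sizes only)**: for two data towers of CONTRACTIONS `W` (level-`k` problem), `W′` (level-`(k+1)` problem) with per-level
sizes `‖W i − 1‖, ‖W′ i − 1‖ ≤ a_i` and per-level consistency `‖W′ i − W i‖ ≤ c_i` per bond, and `L ≥ 2`:
`‖TBal W′ (k+1) y (L·j+r) μ t′ − TBal W k y j μ ⌊(r_μ + t′)/L⌋‖ ≤ thetaBal d L a c k ⌊t′/L⌋` — data consistency along the common prefix (`consBal`) plus twice the sizes of the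
levels the carry cascade at `⌊t′/L⌋` can move, finest step included (`tailBal`).  No curvature / field-strength letter is used.
[cite: Balaban1985BackgroundPropagators, (3.15) p.393 (shape); Balaban1985Averaging, (125) p.36 (shape)] [folklore] -/
theorem TBal_two_level_entry [Nonempty o] (hL : 2 ≤ L) {W W' : (i : ℕ) → Fin d → (idx L M i → Matrix o o ℂ)} {a c : ℕ → ℝ}
    (ha : ∀ i, 0 ≤ a i) (hc : ∀ i, 0 ≤ c i)
    (hWn : ∀ i ν b, ‖W i ν b‖ ≤ 1) (hW'n : ∀ i ν b, ‖W' i ν b‖ ≤ 1)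
    (hWa : ∀ i ν b, ‖W i ν b - 1‖ ≤ a i) (hW'a : ∀ i ν b, ‖W' i ν b - 1‖ ≤ a i)
    (hWc : ∀ i ν b, ‖W' i ν b - W i ν b‖ ≤ c i)
    (k : ℕ) (y : Tor M) (μ : Fin d) (j : Fin d → Fin (lev L k)) (r : Fin d → Fin L) (t' : ℕ) :
    ‖TBal L M W' (k + 1) y (glue (lev L k) L (j, r)) μ t' - TBal L M W k y j μ (((r μ : ℕ) + t') / L)‖
      ≤ thetaBal d L a c k (t' / L) := by
  have hL0 : 0 < L := by omega
  set t₀ := t' / L with ht₀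
  -- the finest step and its size
  set S := stepT L M W' (k + 1) y (fun ν => L * (j ν : ℕ) + (r ν : ℕ)) μ t' (k + 1) with hS
  have hSn : ‖S‖ ≤ 1 := norm_stepT_le_one L M hW'n _ _ _ _ _ _
  have hS1 : ‖S - 1‖ ≤ (1 + a (k + 1)) ^ ((d + 1) * L) - 1 := norm_stepT_sub_one_le L M ha hW'a _ _ _ _ _ _
  have htail0 := tailBal_nonneg (d := d) L ha k t₀
  have hcons0 := consBal_nonneg (d := d) L hc k
  rw [TBal_succ L M W' k y j r μ t']
  rcases parent_pos_cases L (r μ).isLt t' with h0 | h1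
  · -- NO CARRY: the geometric parent is the compositional parent
    rw [h0]
    set P₀ := TBal L M W' k y j μ t₀
    set Q := TBal L M W k y j μ t₀
    have hQn : ‖Q‖ ≤ 1 := norm_list_prod_le_one _ _ fun i' _ => norm_stepT_le_one L M hWn _ _ _ _ _ _
    have e : P₀ * S - Q = (P₀ - Q) * S + Q * (S - 1) := by noncomm_ring
    rw [e]
    calc _ ≤ ‖(P₀ - Q) * S‖ + ‖Q * (S - 1)‖ := norm_add_le _ _
      _ ≤ ‖P₀ - Q‖ * ‖S‖ + ‖Q‖ * ‖S - 1‖ := add_le_add (norm_mul_le _ _) (norm_mul_le _ _)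
      _ ≤ consBal d L c k * 1 + 1 * tailBal d L a k t₀ := by
          gcongr
          · exact norm_prefix_sub_prefix_le L M hc hWn hW'n hWc le_rfl y _ μ t₀
          · exact hS1.trans (pow_sub_one_le_tailBal (d := d) L ha k t₀)
      _ ≤ thetaBal d L a c k t₀ := by unfold thetaBal; linarith
  · -- CARRY: the geometric parent is the successor; split both chains at the cut
    rw [h1]
    set m := cutBal L k t₀ with hm
    have hmk : m ≤ k := cutBal_le L k t₀
    have hsplit := range_split hmk
    -- the four blocks
    set A' := ((List.range m).map fun i' => stepT L M W' k y (fun ν => (j ν : ℕ)) μ t₀ (i' + 1)).prod with hA'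
    set A := ((List.range m).map fun i' => stepT L M W k y (fun ν => (j ν : ℕ)) μ t₀ (i' + 1)).prod with hA
    set X₀ := (((List.range (k - m)).map (m + ·)).map fun i' => stepT L M W' k y (fun ν => (j ν : ℕ)) μ t₀ (i' + 1)).prod with hX₀
    set Y := (((List.range (k - m)).map (m + ·)).map fun i' => stepT L M W k y (fun ν => (j ν : ℕ)) μ (t₀ + 1) (i' + 1)).prod with hY
    have hP : TBal L M W' k y j μ t₀ = A' * X₀ := by
      rw [TBal, hsplit, List.map_append, List.prod_append]
    have hQ : TBal L M W k y j μ (t₀ + 1) = A * Y := by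
      rw [TBal, hsplit, List.map_append, List.prod_append, hm, TBal_prefix_eq L M hL W k t₀ y _ μ]
    rw [hP, hQ, Matrix.mul_assoc]
    have hAn : ‖A‖ ≤ 1 := norm_list_prod_le_one _ _ fun i' _ => norm_stepT_le_one L M hWn _ _ _ _ _ _
    have hX₀n : ‖X₀‖ ≤ 1 := norm_list_prod_le_one _ _ fun i' _ => norm_stepT_le_one L M hW'n _ _ _ _ _ _
    have hXSn : ‖X₀ * S‖ ≤ 1 := (norm_mul_le _ _).trans (by nlinarith [norm_nonneg X₀, norm_nonneg S])
    -- sizes of the tail blocks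
    have hX₀1 : ‖X₀ - 1‖ ≤ ((List.range (k - m)).map fun i' => (1 + a (m + i' + 1)) ^ ((d + 1) * L)).prod - 1 := by
      have h := norm_prod_stepT_sub_one_le L M ha hW'a k y (fun ν => (j ν : ℕ)) μ t₀ ((List.range (k - m)).map (m + ·))
      rw [List.map_map] at h
      rw [hX₀, List.map_map]
      refine h.trans (le_of_eq ?_)
      rw [List.map_map]; rfl
    have hY1 : ‖Y - 1‖ ≤ ((List.range (k - m)).map fun i' => (1 + a (m + i' + 1)) ^ ((d + 1) * L)).prod - 1 := by
      have h := norm_prod_stepT_sub_one_le L M ha hWa k y (fun ν => (j ν : ℕ)) μ (t₀ + 1) ((List.range (k - m)).map (m + ·))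
      rw [List.map_map] at h
      rw [hY, List.map_map]
      refine h.trans (le_of_eq ?_)
      rw [List.map_map]; rfl
    -- the cascade product, finest step included, is `tailBal`
    have hprod1 : 1 ≤ ((List.range (k - m)).map fun i' => (1 + a (m + i' + 1)) ^ ((d + 1) * L)).prod :=
      one_le_prod_of_one_le _ _ fun i => one_le_pow₀ (by linarith [ha (m + i + 1)])
    have hfin1 : 1 ≤ (1 + a (k + 1)) ^ ((d + 1) * L) := one_le_pow₀ (by linarith [ha (k + 1)])
    have htail : ((List.range (k - m)).map fun i' => (1 + a (m + i' + 1)) ^ ((d + 1) * L)).prod * (1 + a (k + 1)) ^ ((d + 1) * L) - 1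
        = tailBal d L a k t₀ := by
      unfold tailBal
      rw [← hm, show k + 1 - m = (k - m) + 1 by omega, List.range_succ, List.map_append, List.prod_append, List.map_singleton,
        List.prod_singleton, show m + (k - m) + 1 = k + 1 by omega]
    have hXS1 : ‖X₀ * S - 1‖ ≤ tailBal d L a k t₀ := by
      refine (norm_mul_sub_one_le hX₀1 hS1).trans (le_of_eq ?_)
      rw [← htail]; ring
    have hY1' : ‖Y - 1‖ ≤ tailBal d L a k t₀ := by
      refine hY1.trans ?_
      rw [← htail]
      refine sub_le_sub_right ?_ 1
      exact le_mul_of_one_le_right (zero_le_one.trans hprod1) hfin1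
    calc ‖A' * (X₀ * S) - A * Y‖ ≤ ‖A' - A‖ + ‖X₀ * S - 1‖ + ‖Y - 1‖ := norm_mul_sub_mul_le_three hAn hXSn
      _ ≤ consBal d L c k + tailBal d L a k t₀ + tailBal d L a k t₀ :=
          add_le_add (add_le_add (norm_prefix_sub_prefix_le L M hc hWn hW'n hWc hmk y _ μ t₀) hXS1) hY1'
      _ = thetaBal d L a c k t₀ := by unfold thetaBal; ring

end Summit.QuantumFields.BalabanUV.T4Continuum.NE2.CovariantTableBalabanTwoLevel

end
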